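import Summits.KontsevichZagierPeriods.KontsevichZagierPeriods.Theorems.K2SymbolChainsJensenIsScissorsDilation

/-!
# Jensen is scissors — the dilation lemma `log (K V) ~ log K + log V` for signed unfoldings

Support file for item stmt-KontsevichZagierPeriods-5204 (`JensenIsScissors`, route
KontsevichZagierPeriods/K2SymbolChains). Write `L(T, G, W)` for the signed unfolding
`[{(b, u) | b ∈ T, u between 1 and W b}, ±G(b)/u]` of `G · log W` over a base `T`
(`KZ.logUnfoldDomain`, `KZ.logUnfoldIntegrand` of `KZTorusLogRep.lean`). For `K ≥ 1`, `V > 0`,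
`K V ≥ 1` on `T` (`K` differentiable at the points of `T`), and any subgroup `S` containing the
three scissors move sets,

  `[L(T, G, K V)] − [L(T, G, K)] − [L(T, G, V)] ∈ S`            (`of_logUnfold_mul_sub_sub_mem`).

Over `{V ≥ 1}` this is the cut of the band `(1, K V)` at `u = K` (rule 1a), the graph of `K` being
null) followed by the fibrewise dilation `u ↦ K(b) u` carrying `(1, V)` onto `(K, K V)` (rule 2),
the integrand `G/u` being dilation invariant); over `{V < 1}` it is the cut of `(1, K)` at `u = K V`
and the dilation carrying the negative sheet `(V, 1)` (integrand `−G/u`) onto `(K V, K)`, plus the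
cancellation `[σ, f] + [σ, −f] ∈ S`. No Newton–Leibniz move is used.
[Kontsevich–Zagier 2001, §1.1–1.2, rules 1)–2)] [folklore]
-/

noncomputable section

open MeasureTheory Set
open Literature.NumberTheory.Transcendental Literature.ModelTheory.ExponentialFields

namespace Summit.KontsevichZagierPeriods.K2SymbolChains.JensenIsScissorsProof

open Literature.NumberTheory.Transcendental.KZ

variable {m : ℕ} {S : AddSubgroup FormalRep}

/-! ### The two halves of the dilation lemma -/

/-- **`log (K V) ~ log K + log V` over `{V ≥ 1}`** (`K ≥ 1`): cut `(1, K V)` at `u = K` and dilate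
`(1, V)` onto `(K, K V)`. [Kontsevich–Zagier 2001, §1.2, rules 1)–2)] [folklore] -/
theorem of_logUnfold_mul_sub_sub_mem_of_one_le
    (hS : domainAddRel ∪ integrandAddRel ∪ changeOfVariablesRel ⊆ S)
    {T : Set (Fin m → ℝ)} {G K V : (Fin m → ℝ) → ℝ} (hT : IsSemialgebraic ℚ T)
    (hK : IsSemialgebraicFunOn ℚ T K) (hV : IsSemialgebraicFunOn ℚ T V)
    (hK1 : ∀ b ∈ T, 1 ≤ K b) (hV1 : ∀ b ∈ T, 1 ≤ V b) (hKd : ∀ b ∈ T, DifferentiableAt ℝ K b)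
    (RKV RK RV : IntegralRep (m + 1))
    (hKVd : RKV.domain = logUnfoldDomain T (fun b => K b * V b))
    (hKVi : EqOn RKV.integrand (logUnfoldIntegrand G) RKV.domain)
    (hKdom : RK.domain = logUnfoldDomain T K) (hKi : EqOn RK.integrand (logUnfoldIntegrand G) RK.domain)
    (hVd : RV.domain = logUnfoldDomain T V) (hVi : EqOn RV.integrand (logUnfoldIntegrand G) RV.domain) :
    of RKV - of RK - of RV ∈ S := by
  have hKpos : ∀ b ∈ T, 0 < K b := fun b hb => one_pos.trans_le (hK1 b hb)
  have hKV1 : ∀ b ∈ T, 1 ≤ K b * V b := fun b hb => by nlinarith [hK1 b hb, hV1 b hb]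
  have hc1 : IsSemialgebraicFunOn ℚ T (fun _ => (1 : ℝ)) := by
    simpa using isSemialgebraicFunOn_ratCast hT 1
  have hKV : IsSemialgebraicFunOn ℚ T (fun b => K b * V b) := IsSemialgebraicFunOn.mul_holds hK hV
  -- the two pieces of `RKV.domain`
  set A : Set (Fin (m + 1) → ℝ) := {z | Fin.init z ∈ T ∧ (fun _ => (1 : ℝ)) (Fin.init z) <
    z (Fin.last m) ∧ z (Fin.last m) < K (Fin.init z)} with hA_def
  set B : Set (Fin (m + 1) → ℝ) := {z | Fin.init z ∈ T ∧ K (Fin.init z) < z (Fin.last m) ∧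
    z (Fin.last m) < (fun b => K b * V b) (Fin.init z)} with hB_def
  have hAs : IsSemialgebraic ℚ A := isSemialgebraic_oband hc1 hK
  have hBs : IsSemialgebraic ℚ B := isSemialgebraic_oband hK hKV
  have hAr : A ⊆ RKV.domain := by
    rintro z ⟨hb, h1, h2⟩
    rw [hKVd]
    exact ⟨hb, Or.inl ⟨h1, h2.trans_le (by nlinarith [hKpos _ hb, hV1 _ hb])⟩⟩
  have hBr : B ⊆ RKV.domain := by
    rintro z ⟨hb, h1, h2⟩
    rw [hKVd]
    exact ⟨hb, Or.inl ⟨(hK1 _ hb).trans_lt h1, h2⟩⟩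
  have hAB : volume (A ∩ B) = 0 := by
    rw [show A ∩ B = ∅ by
      ext z
      simp only [hA_def, hB_def, mem_inter_iff, mem_setOf_eq, mem_empty_iff_false, iff_false]
      rintro ⟨⟨-, -, h1⟩, -, h2, -⟩
      exact lt_asymm h1 h2]
    exact measure_empty
  have hcover : volume (RKV.domain \ (A ∪ B)) = 0 := by
    refine measure_mono_null (fun z hz => ?_) (volume_graph_eq_zero hK)
    rw [hKVd] at hz
    rcases hz with ⟨⟨hb, h | h⟩, hn⟩
    · simp only [hA_def, hB_def, mem_union, mem_setOf_eq, not_or, not_and, not_lt] at hn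
      refine ⟨hb, le_antisymm ?_ (hn.1 hb h.1)⟩
      by_contra hlt
      exact (not_lt.2 (hn.2 hb (not_le.1 hlt))) h.2
    · exact absurd (h.1.trans h.2) (not_lt.2 (hKV1 _ hb))
  set RA := RKV.restrict A hAs hAr with hRA
  set RB := RKV.restrict B hBs hBr with hRB
  have e1 : of RKV - of RA - of RB ∈ S :=
    of_sub_restrict_sub_restrict_mem_of_null hS RKV hAs hBs hAr hBr hAB hcover
  -- `RA` is `RK`
  have e2 : of RA - of RK ∈ S := by
    refine of_sub_of_mem_of_eqOn hS ?_ (fun z hz => ?_)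
    · rw [hKdom, hRA, IntegralRep.domain_restrict, hA_def, logUnfoldDomain_eq_of_one_le hK1]
    · rw [hRA, IntegralRep.integrand_restrict, hKVi (hAr hz), hKi]
      rw [hKdom, logUnfoldDomain_eq_of_one_le hK1]
      exact hz
  -- `RV` goes to `RB` by the dilation
  have e3 : of RV - of RB ∈ S := by
    refine of_sub_of_mem_lastCoord hS (F := fun w => K (Fin.init w) * w (Fin.last m))
      (F' := fun z => fderiv ℝ (fun w : Fin (m + 1) → ℝ => K (Fin.init w) * w (Fin.last m)) z)
      hc1 hV hV1 RV RB (by rw [hVd, logUnfoldDomain_eq_of_one_le hV1]) ?_ ?_ ?_ ?_ ?_ ?_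
    · exact isSemialgebraicFunOn_dilation hK RV.isSemialgebraic_domain (fun z hz => by
        rw [hVd] at hz; exact hz.1)
    · intro z hz
      rw [hVd] at hz
      exact (differentiableAt_dilation (hKd _ hz.1)).hasFDerivAt
    · intro b _
      exact (continuous_const.mul continuous_id : Continuous fun t : ℝ => K b * t).continuousOn.congr
        (fun t _ => by simp)
    · intro b hb
      exact fun s _ t _ hst => by
        simp only [Fin.init_snoc, Fin.snoc_last]
        exact mul_lt_mul_of_pos_left hst (hKpos b hb)
    · rw [hRB, IntegralRep.domain_restrict, hB_def]
      ext z
      simp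
    · intro z hz
      have hz' := hz
      rw [hVd, logUnfoldDomain_eq_of_one_le hV1] at hz'
      obtain ⟨hb, h1, h2⟩ := hz'
      have hKb := hKpos _ hb
      have hu : 0 < z (Fin.last m) := one_pos.trans h1
      have hmem : (Fin.snoc (Fin.init z) (K (Fin.init z) * z (Fin.last m)) : Fin (m + 1) → ℝ) ∈
          RKV.domain := by
        refine hBr ⟨by simpa using hb, ?_, ?_⟩
        · simpa using mul_lt_mul_of_pos_left h1 hKb
        · simpa using mul_lt_mul_of_pos_left h2 hKb
      rw [hVi hz, hRB, IntegralRep.integrand_restrict, hKVi hmem,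
        fderiv_dilation_single (hKd _ hb), logUnfoldIntegrand, logUnfoldIntegrand]
      have h1' : (1 : ℝ) < K (Fin.init z) * z (Fin.last m) := by nlinarith [hK1 _ hb]
      simp only [Fin.snoc_last, Fin.init_snoc, if_pos h1, if_pos h1', abs_of_pos hKb]
      field_simp
  have : of RKV - of RK - of RV = (of RKV - of RA - of RB) + (of RA - of RK) - (of RV - of RB) := by
    abel
  rw [this]
  exact S.sub_mem (S.add_mem e1 e2) e3

/-- **`log (K V) ~ log K + log V` over `{V < 1}`** (`K ≥ 1`, `K V ≥ 1`): cut `(1, K)` at `u = K V`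
and dilate the negative sheet `(V, 1)` onto `(K V, K)`, the integrand changing sign.
[Kontsevich–Zagier 2001, §1.2, rules 1)–2)] [folklore] -/
theorem of_logUnfold_mul_sub_sub_mem_of_lt_one
    (hS : domainAddRel ∪ integrandAddRel ∪ changeOfVariablesRel ⊆ S)
    {T : Set (Fin m → ℝ)} {G K V : (Fin m → ℝ) → ℝ} (hT : IsSemialgebraic ℚ T)
    (hK : IsSemialgebraicFunOn ℚ T K) (hV : IsSemialgebraicFunOn ℚ T V)
    (hK1 : ∀ b ∈ T, 1 ≤ K b) (hV0 : ∀ b ∈ T, 0 < V b) (hV1 : ∀ b ∈ T, V b < 1)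
    (hKV1 : ∀ b ∈ T, 1 ≤ K b * V b) (hKd : ∀ b ∈ T, DifferentiableAt ℝ K b)
    (RKV RK RV : IntegralRep (m + 1))
    (hKVd : RKV.domain = logUnfoldDomain T (fun b => K b * V b))
    (hKVi : EqOn RKV.integrand (logUnfoldIntegrand G) RKV.domain)
    (hKdom : RK.domain = logUnfoldDomain T K) (hKi : EqOn RK.integrand (logUnfoldIntegrand G) RK.domain)
    (hVd : RV.domain = logUnfoldDomain T V) (hVi : EqOn RV.integrand (logUnfoldIntegrand G) RV.domain) :
    of RKV - of RK - of RV ∈ S := by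
  have hKpos : ∀ b ∈ T, 0 < K b := fun b hb => one_pos.trans_le (hK1 b hb)
  have hc1 : IsSemialgebraicFunOn ℚ T (fun _ => (1 : ℝ)) := by
    simpa using isSemialgebraicFunOn_ratCast hT 1
  have hKV : IsSemialgebraicFunOn ℚ T (fun b => K b * V b) := IsSemialgebraicFunOn.mul_holds hK hV
  have hKVltK : ∀ b ∈ T, K b * V b < K b := fun b hb => by nlinarith [hKpos b hb, hV1 b hb]
  -- the two pieces of `RK.domain`
  set C : Set (Fin (m + 1) → ℝ) := {z | Fin.init z ∈ T ∧ (fun _ => (1 : ℝ)) (Fin.init z) <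
    z (Fin.last m) ∧ z (Fin.last m) < (fun b => K b * V b) (Fin.init z)} with hC_def
  set D : Set (Fin (m + 1) → ℝ) := {z | Fin.init z ∈ T ∧ (fun b => K b * V b) (Fin.init z) <
    z (Fin.last m) ∧ z (Fin.last m) < K (Fin.init z)} with hD_def
  have hCs : IsSemialgebraic ℚ C := isSemialgebraic_oband hc1 hKV
  have hDs : IsSemialgebraic ℚ D := isSemialgebraic_oband hKV hK
  have hCr : C ⊆ RK.domain := by
    rintro z ⟨hb, h1, h2⟩
    rw [hKdom]
    exact ⟨hb, Or.inl ⟨h1, h2.trans (hKVltK _ hb)⟩⟩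
  have hDr : D ⊆ RK.domain := by
    rintro z ⟨hb, h1, h2⟩
    rw [hKdom]
    exact ⟨hb, Or.inl ⟨(hKV1 _ hb).trans_lt h1, h2⟩⟩
  have hCD : volume (C ∩ D) = 0 := by
    rw [show C ∩ D = ∅ by
      ext z
      simp only [hC_def, hD_def, mem_inter_iff, mem_setOf_eq, mem_empty_iff_false, iff_false]
      rintro ⟨⟨-, -, h1⟩, -, h2, -⟩
      exact lt_asymm h1 h2]
    exact measure_empty
  have hcover : volume (RK.domain \ (C ∪ D)) = 0 := by
    refine measure_mono_null (fun z hz => ?_) (volume_graph_eq_zero hKV)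
    rw [hKdom] at hz
    rcases hz with ⟨⟨hb, h | h⟩, hn⟩
    · simp only [hC_def, hD_def, mem_union, mem_setOf_eq, not_or, not_and, not_lt] at hn
      refine ⟨hb, le_antisymm ?_ (hn.1 hb h.1)⟩
      by_contra hlt
      exact (not_lt.2 (hn.2 hb (not_le.1 hlt))) h.2
    · exact absurd (h.1.trans h.2) (not_lt.2 (hK1 _ hb))
  set RC := RK.restrict C hCs hCr with hRC
  set RD := RK.restrict D hDs hDr with hRD
  have e1 : of RK - of RC - of RD ∈ S :=
    of_sub_restrict_sub_restrict_mem_of_null hS RK hCs hDs hCr hDr hCD hcover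
  -- `RC` is `RKV`
  have e2 : of RC - of RKV ∈ S := by
    refine of_sub_of_mem_of_eqOn hS ?_ (fun z hz => ?_)
    · rw [hKVd, hRC, IntegralRep.domain_restrict, hC_def, logUnfoldDomain_eq_of_one_le hKV1]
    · rw [hRC, IntegralRep.integrand_restrict, hKi (hCr hz), hKVi]
      rw [hKVd, logUnfoldDomain_eq_of_one_le hKV1]
      exact hz
  -- `RV` goes to `RD.neg` by the dilation
  have e3 : of RV - of RD.neg ∈ S := by
    refine of_sub_of_mem_lastCoord hS (F := fun w => K (Fin.init w) * w (Fin.last m))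
      (F' := fun z => fderiv ℝ (fun w : Fin (m + 1) → ℝ => K (Fin.init w) * w (Fin.last m)) z)
      hV hc1 (fun b hb => (hV1 b hb).le) RV RD.neg
      (by rw [hVd, logUnfoldDomain_eq_of_le_one (fun b hb => (hV1 b hb).le)])
      ?_ ?_ ?_ ?_ ?_ ?_
    · exact isSemialgebraicFunOn_dilation hK RV.isSemialgebraic_domain (fun z hz => by
        rw [hVd] at hz; exact hz.1)
    · intro z hz
      rw [hVd] at hz
      exact (differentiableAt_dilation (hKd _ hz.1)).hasFDerivAt
    · intro b _
      exact (continuous_const.mul continuous_id : Continuous fun t : ℝ => K b * t).continuousOn.congr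
        (fun t _ => by simp)
    · intro b hb
      exact fun s _ t _ hst => by
        simp only [Fin.init_snoc, Fin.snoc_last]
        exact mul_lt_mul_of_pos_left hst (hKpos b hb)
    · rw [IntegralRep.domain_neg, hRD, IntegralRep.domain_restrict, hD_def]
      ext z
      simp
    · intro z hz
      have hz' := hz
      rw [hVd, logUnfoldDomain_eq_of_le_one (fun b hb => (hV1 b hb).le)] at hz'
      obtain ⟨hb, h1, h2⟩ := hz'
      have hKb := hKpos _ hb
      have hu : 0 < z (Fin.last m) := (hV0 _ hb).trans h1
      have hmem : (Fin.snoc (Fin.init z) (K (Fin.init z) * z (Fin.last m)) : Fin (m + 1) → ℝ) ∈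
          RK.domain := by
        refine hDr ⟨by simpa using hb, ?_, ?_⟩
        · simpa using mul_lt_mul_of_pos_left h1 hKb
        · simpa using mul_lt_mul_of_pos_left h2 hKb
      rw [hVi hz, IntegralRep.integrand_neg, Pi.neg_apply, hRD, IntegralRep.integrand_restrict,
        hKi hmem, fderiv_dilation_single (hKd _ hb), logUnfoldIntegrand, logUnfoldIntegrand]
      have h1' : (1 : ℝ) < K (Fin.init z) * z (Fin.last m) :=
        (hKV1 _ hb).trans_lt (by simpa using mul_lt_mul_of_pos_left h1 hKb)
      have h2' : ¬ (1 : ℝ) < z (Fin.last m) := not_lt.2 h2.le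
      simp only [Fin.snoc_last, Fin.init_snoc, if_neg h2', if_pos h1', abs_of_pos hKb]
      field_simp
  have e4 : of RD + of RD.neg ∈ S := of_add_of_neg_mem hS RD
  have : of RKV - of RK - of RV =
      -(of RK - of RC - of RD) - (of RC - of RKV) - (of RD + of RD.neg) - (of RV - of RD.neg) := by
    abel
  rw [this]
  exact S.sub_mem (S.sub_mem (S.sub_mem (S.neg_mem e1) e2) e4) e3

/-! ### The dilation lemma over a general base -/

/-- **`log (K V) ~ log K + log V` for signed unfoldings, inside `S`**: for `K ≥ 1`, `V > 0`,
`K V ≥ 1` on the `ℚ`-semialgebraic base `T` (`K`, `V` `ℚ`-semialgebraic, `K` differentiable at the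
points of `T`) and representations `RKV`, `RK`, `RV` with the signed unfolding domains of
`log (K V)`, `log K`, `log V` over `T` and the signed unfolding integrand `±G/u`,
`[RKV] − [RK] − [RV] ∈ S` (split the base into `{V ≥ 1}` and `{V < 1}`, rule 1a), and use the two
halves). [Kontsevich–Zagier 2001, §1.2, rules 1)–2)] [folklore] -/
theorem of_logUnfold_mul_sub_sub_mem
    (hS : domainAddRel ∪ integrandAddRel ∪ changeOfVariablesRel ⊆ S)
    {T : Set (Fin m → ℝ)} {G K V : (Fin m → ℝ) → ℝ} (hT : IsSemialgebraic ℚ T)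
    (hK : IsSemialgebraicFunOn ℚ T K) (hV : IsSemialgebraicFunOn ℚ T V)
    (hK1 : ∀ b ∈ T, 1 ≤ K b) (hV0 : ∀ b ∈ T, 0 < V b) (hKV1 : ∀ b ∈ T, 1 ≤ K b * V b)
    (hKd : ∀ b ∈ T, DifferentiableAt ℝ K b)
    (RKV RK RV : IntegralRep (m + 1))
    (hKVd : RKV.domain = logUnfoldDomain T (fun b => K b * V b))
    (hKVi : EqOn RKV.integrand (logUnfoldIntegrand G) RKV.domain)
    (hKdom : RK.domain = logUnfoldDomain T K) (hKi : EqOn RK.integrand (logUnfoldIntegrand G) RK.domain)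
    (hVd : RV.domain = logUnfoldDomain T V) (hVi : EqOn RV.integrand (logUnfoldIntegrand G) RV.domain) :
    of RKV - of RK - of RV ∈ S := by
  -- the piece of the base where `V ≥ 1`
  have hV1s : IsSemialgebraicFunOn ℚ T (fun b => V b - 1) :=
    (IsSemialgebraicFunOn.sub_holds hV (isSemialgebraicFunOn_ratCast hT 1)).congr fun b _ => by simp
  set P : Set (Fin m → ℝ) := {b | b ∈ T ∧ 0 ≤ V b - 1} with hP_def
  have hP : IsSemialgebraic ℚ P := hV1s.isSemialgebraic_sep_nonneg
  have hTP : IsSemialgebraic ℚ (T ∩ P) := hT.inter hP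
  have hTP' : IsSemialgebraic ℚ (T \ P) := hT.diff hP
  have hge : ∀ b ∈ T ∩ P, 1 ≤ V b := fun b hb => by have := hb.2.2; linarith
  have hlt : ∀ b ∈ T \ P, V b < 1 := fun b hb => by
    by_contra h
    exact hb.2 ⟨hb.1, by linarith [not_lt.1 h]⟩
  -- split the three representations over `P`
  have sKV := of_sub_restrict_base_mem hS RKV hP
  have sK := of_sub_restrict_base_mem hS RK hP
  have sV := of_sub_restrict_base_mem hS RV hP
  -- the two halves
  have h₁ := of_logUnfold_mul_sub_sub_mem_of_one_le hS (G := G) hTP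
    (hK.mono inter_subset_left hTP) (hV.mono inter_subset_left hTP)
    (fun b hb => hK1 b hb.1) hge (fun b hb => hKd b hb.1)
    (RKV.restrict (RKV.domain ∩ {z | Fin.init z ∈ P})
      (RKV.isSemialgebraic_domain.inter (isSemialgebraic_cyl hP)) inter_subset_left)
    (RK.restrict (RK.domain ∩ {z | Fin.init z ∈ P})
      (RK.isSemialgebraic_domain.inter (isSemialgebraic_cyl hP)) inter_subset_left)
    (RV.restrict (RV.domain ∩ {z | Fin.init z ∈ P})
      (RV.isSemialgebraic_domain.inter (isSemialgebraic_cyl hP)) inter_subset_left)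
    (by rw [IntegralRep.domain_restrict, hKVd, logUnfoldDomain_inter_cyl])
    (fun z hz => hKVi hz.1)
    (by rw [IntegralRep.domain_restrict, hKdom, logUnfoldDomain_inter_cyl])
    (fun z hz => hKi hz.1)
    (by rw [IntegralRep.domain_restrict, hVd, logUnfoldDomain_inter_cyl])
    (fun z hz => hVi hz.1)
  have h₂ := of_logUnfold_mul_sub_sub_mem_of_lt_one hS (G := G) hTP'
    (hK.mono sdiff_subset hTP') (hV.mono sdiff_subset hTP')
    (fun b hb => hK1 b hb.1) (fun b hb => hV0 b hb.1) hlt (fun b hb => hKV1 b hb.1)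
    (fun b hb => hKd b hb.1)
    (RKV.restrict (RKV.domain \ {z | Fin.init z ∈ P})
      (RKV.isSemialgebraic_domain.diff (isSemialgebraic_cyl hP)) sdiff_subset)
    (RK.restrict (RK.domain \ {z | Fin.init z ∈ P})
      (RK.isSemialgebraic_domain.diff (isSemialgebraic_cyl hP)) sdiff_subset)
    (RV.restrict (RV.domain \ {z | Fin.init z ∈ P})
      (RV.isSemialgebraic_domain.diff (isSemialgebraic_cyl hP)) sdiff_subset)
    (by rw [IntegralRep.domain_restrict, hKVd, logUnfoldDomain_diff_cyl])
    (fun z hz => hKVi hz.1)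
    (by rw [IntegralRep.domain_restrict, hKdom, logUnfoldDomain_diff_cyl])
    (fun z hz => hKi hz.1)
    (by rw [IntegralRep.domain_restrict, hVd, logUnfoldDomain_diff_cyl])
    (fun z hz => hVi hz.1)
  -- assemble
  set a₁ := of (RKV.restrict (RKV.domain ∩ {z | Fin.init z ∈ P})
      (RKV.isSemialgebraic_domain.inter (isSemialgebraic_cyl hP)) inter_subset_left)
  set a₂ := of (RKV.restrict (RKV.domain \ {z | Fin.init z ∈ P})
      (RKV.isSemialgebraic_domain.diff (isSemialgebraic_cyl hP)) sdiff_subset)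
  set b₁ := of (RK.restrict (RK.domain ∩ {z | Fin.init z ∈ P})
      (RK.isSemialgebraic_domain.inter (isSemialgebraic_cyl hP)) inter_subset_left)
  set b₂ := of (RK.restrict (RK.domain \ {z | Fin.init z ∈ P})
      (RK.isSemialgebraic_domain.diff (isSemialgebraic_cyl hP)) sdiff_subset)
  set c₁ := of (RV.restrict (RV.domain ∩ {z | Fin.init z ∈ P})
      (RV.isSemialgebraic_domain.inter (isSemialgebraic_cyl hP)) inter_subset_left)
  set c₂ := of (RV.restrict (RV.domain \ {z | Fin.init z ∈ P})
      (RV.isSemialgebraic_domain.diff (isSemialgebraic_cyl hP)) sdiff_subset)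
  have : of RKV - of RK - of RV = (of RKV - a₁ - a₂) - (of RK - b₁ - b₂) - (of RV - c₁ - c₂) +
      (a₁ - b₁ - c₁) + (a₂ - b₂ - c₂) := by abel
  rw [this]
  exact S.add_mem (S.add_mem (S.sub_mem (S.sub_mem sKV sK) sV) h₁) h₂

end Summit.KontsevichZagierPeriods.K2SymbolChains.JensenIsScissorsProof
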